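import Summits.NavierStokesRegularity.NavierStokesRegularity.Theorems.FilamentSkeletonRssKelvinGateTools
import Summits.NavierStokesRegularity.NavierStokesRegularity.Theorems.FilamentSkeletonRssTransverseReductionRJCensus

/-!
# Route `FilamentSkeletonRss` · crux `TransverseReductionRJ` (stmt-NavierStokesRegularity-21221) — line `kelvin_gate`,
# stub S2 `PolynomialKelvinGate`: the box premise is only inhabited in the NON-DEGENERATE parameter region
# (normal form of the stub, second half)

Helper file (theorems only, `--supports stmt-NavierStokesRegularity-21221 --as helper`), in the vocabulary of
`FilamentSkeletonRssKelvinGateDefs`.  HONEST FRAMING: bookkeeping for a HYPOTHETICAL filament-type RSS blow-up route;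
nothing here bears on Navier–Stokes regularity; no stub is proved here.

The parameter census of the crux (`transverseReductionRJ_iff_nondegenerate`, p528784 and its J-port) showed that the
box clauses 0–13J are contradictory at every `Γ ≥ 1` outside the region
`cg ≤ 1 ∧ θ₀ ≤ 1 ∧ 0 ≤ K ∧ 3/2 + δ ≤ Λ ∧ 0 ≤ cnd ∧ (2 ≤ N → ρ ≤ 2 Rw) ∧ (N = 1 → 0 < K)`.
Every stub of the line `kelvin_gate` carries the same box premise (`DefU → DefV → … → BoxClausesJ → …`), so the same
census applies to the stubs.  This file packages it in the line's vocabulary: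

* `BoxClausesJ.nondegenerate` — `DefU`, `DefV`, `BoxClausesJ` at `Γ > 0` force the seven non-degeneracy
  inequalities (reusable by S1, S3, S4 alike);
* `polynomialKelvinGate_iff_nondegenerate` — **normal form of S2**: `PolynomialKelvinGate` is equivalent to its
  restriction to non-degenerate parameters, positive size constant `Cs > 0`, non-negative residual constant
  `Cr ≥ 0`, and thresholds `Γ₁ ≥ 1` (combining `polynomialKelvinGate_iff_pos`).  This is the honest statement a
  prover of S2 faces; everything stripped off holds vacuously.
-/

set_option linter.dupNamespace false

noncomputable section

namespace Summit.NavierStokesRegularity.NavierStokesRegularity.Theorems.KelvinGate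

open Set Function Filter
open Literature.Analysis.FluidPDE
open Summit.NavierStokesRegularity.NavierStokesRegularity.Theorems.TransverseReductionRCensus
open scoped InnerProductSpace Topology

/-- **The box premise forces the non-degenerate parameter region.**  If the regularised Biot–Savart field `u`
(`DefU`), the frame field `v` (`DefV`) and a box datum satisfying clauses 0–13J (`BoxClausesJ`) exist at some `Γ > 0`
(with `0 < N`, `0 < δ`, `0 < ρ`, `0 < θ₀`), then `cg ≤ 1`, `θ₀ ≤ 1`, `0 ≤ K`, `3/2 + δ ≤ Λ`, `0 ≤ cnd`,
`2 ≤ N → ρ ≤ 2 Rw` and `N = 1 → 0 < K` (no-return vs. unit speed; `θ₀ ≤ |α| ≤ θ₀⁻¹`; `‖X″‖√Γ ≤ K`;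
`3/2 + δ ≤ w′(c) ≤ Λ`; clause 13J at `Y = 0`; separation vs. waists; a single straight filament has `w′ ≡ 1/2`) —
the lemmas of `FilamentSkeletonRssTransverseReductionRCensus` / `…RJCensus`, evaluated at the corner `p = 0`. -/
theorem BoxClausesJ.nondegenerate {N : ℕ} {Γ δ ρ K Λ a b cnd Rw Rb cg θ₀ : ℝ} {γ : (Fin N → ℝ) → Fin N → ℝ}
    {α : (Fin N → ℝ) → ℝ} {X : (Fin N → ℝ) → Fin N → ℝ → EuclideanSpace ℝ (Fin 3)} {w : (Fin N → ℝ) → Fin N → ℝ → ℝ}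
    {c : (Fin N → ℝ) → Fin N → ℝ} {m n : (Fin N → ℝ) → Fin N → EuclideanSpace ℝ (Fin 3)}
    {u : (Fin N → ℝ) → (Fin N → ℝ → EuclideanSpace ℝ (Fin 3)) → EuclideanSpace ℝ (Fin 3) → EuclideanSpace ℝ (Fin 3)}
    {v : (Fin N → ℝ) → EuclideanSpace ℝ (Fin 3) → EuclideanSpace ℝ (Fin 3)}
    {A : (Fin N → ℝ) → Fin N → (EuclideanSpace ℝ (Fin 3) →L[ℝ] EuclideanSpace ℝ (Fin 3))}
    {T : (Fin N → ℝ) → (Fin N → ℝ → EuclideanSpace ℝ (Fin 3)) → Fin N → ℝ → EuclideanSpace ℝ (Fin 3)}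
    (hN : 0 < N) (hδ : 0 < δ) (hρ : 0 < ρ) (hθ₀ : 0 < θ₀) (hΓ : 0 < Γ)
    (hu : DefU N Γ γ u) (hv : DefV N α X u v) (hbox : BoxClausesJ N Γ δ ρ K Λ a b cnd Rw Rb cg θ₀ γ α X w c m n v A T) :
    cg ≤ 1 ∧ θ₀ ≤ 1 ∧ 0 ≤ K ∧ 3/2 + δ ≤ Λ ∧ 0 ≤ cnd ∧ (2 ≤ N → ρ ≤ 2 * Rw) ∧ (N = 1 → 0 < K) := by
  have hp₀ : ∀ i : Fin N, (fun _ => (0:ℝ)) i ∈ Icc (0:ℝ) 1 := fun _ => ⟨le_rfl, zero_le_one⟩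
  obtain ⟨-, -, hreg, hsep, hnoret, -, hwdef, -, hwaist, -, hbds, hstag, -, h13⟩ := hbox.2 (fun _ => (0:ℝ)) hp₀
  refine ⟨?_, ?_, ?_, ?_, ?_, ?_, ?_⟩
  · exact cg_le_one hρ hΓ (hreg ⟨0, hN⟩).1 (hreg ⟨0, hN⟩).2.2.1 (hnoret ⟨0, hN⟩)
  · exact theta_le_one hθ₀ hbds.1 hbds.2.1
  · exact K_nonneg (c (fun _ => (0:ℝ)) ⟨0, hN⟩) ((hreg ⟨0, hN⟩).2.2.2.1 _)
  · exact (hstag ⟨0, hN⟩).2.2.1.trans (hstag ⟨0, hN⟩).2.2.2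
  · exact cnd_nonneg_ball ⟨0, hN⟩ h13
  · exact fun hN2 => rho_le_two_Rw hΓ hN2 hsep hwaist
  · intro hN1
    subst hN1
    exact K_pos_of_single hδ hΓ (fun k => Γ * γ (fun _ => (0:ℝ)) k / (4 * Real.pi))
      (hu (fun _ => (0:ℝ))) (hv (fun _ => (0:ℝ))) (fun j => (hreg j).1)
      (fun j => (hreg j).2.2.1) (fun j => (hreg j).2.2.2.1) hwdef (fun j => (hstag j).2.2.1)

/-- **Normal form of stub S2 (full).**  `PolynomialKelvinGate` is equivalent to its restriction to the non-degenerate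
parameter region of the census, positive size constants `Cs > 0`, non-negative residual constants `Cr ≥ 0` and
thresholds `Γ₁ ≥ 1`: outside, the premises (`BoxClausesJ` by `BoxClausesJ.nondegenerate`, `BaseSpec` by
`BaseSpec.pos`) are uninhabited at every `Γ ≥ 1`, so the stub holds there vacuously. -/
theorem polynomialKelvinGate_iff_nondegenerate :
    PolynomialKelvinGate ↔
    ∀ (N : ℕ) (δ ρ K Λ a b cnd η Rw Rb cg θ₀ : ℝ), 0 < N → 0 < δ → 0 < ρ → 0 ≤ a → 0 < η → 0 < Rw → 0 < Rb → 0 < cg → 0 < θ₀ →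
    cg ≤ 1 → θ₀ ≤ 1 → 0 ≤ K → 3/2 + δ ≤ Λ → 0 ≤ cnd → (2 ≤ N → ρ ≤ 2 * Rw) → (N = 1 → 0 < K) →
    ∀ Cs : ℝ, 0 < Cs → ∃ κ C₂ : ℝ, ∀ k : ℕ, 1 ≤ k → ∀ Cr : ℝ, 0 ≤ Cr → ∃ Γ₁ : ℝ, 1 ≤ Γ₁ ∧ ∀ Γ : ℝ, Γ₁ ≤ Γ → ∀ (γ : (Fin N → ℝ) → Fin N → ℝ) (α : (Fin N → ℝ) → ℝ) (X : (Fin N → ℝ) → Fin N → ℝ → EuclideanSpace ℝ (Fin 3)) (w : (Fin N → ℝ) → Fin N → ℝ → ℝ) (c : (Fin N → ℝ) → Fin N → ℝ) (m : (Fin N → ℝ) → Fin N → EuclideanSpace ℝ (Fin 3)) (n : (Fin N → ℝ) → Fin N → EuclideanSpace ℝ (Fin 3)) (u : (Fin N → ℝ) → (Fin N → ℝ → EuclideanSpace ℝ (Fin 3)) → EuclideanSpace ℝ (Fin 3) → EuclideanSpace ℝ (Fin 3)) (v : (Fin N → ℝ) → EuclideanSpace ℝ (Fin 3) → EuclideanSpace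 ℝ (Fin 3)) (A : (Fin N → ℝ) → Fin N → (EuclideanSpace ℝ (Fin 3) →L[ℝ] EuclideanSpace ℝ (Fin 3))) (T : (Fin N → ℝ) → (Fin N → ℝ → EuclideanSpace ℝ (Fin 3)) → Fin N → ℝ → EuclideanSpace ℝ (Fin 3)) (D : (Fin N → ℝ) → Fin N → EuclideanSpace ℝ (Fin 3) → EuclideanSpace ℝ (Fin 3)),
      DefU N Γ γ u → DefV N α X u v → DefA N X c v A → DefT N α u T → DefD N X c D → BoxClausesJ N Γ δ ρ K Λ a b cnd Rw Rb cg θ₀ γ α X w c m n v A T →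
      ∀ (U0 : (Fin N → ℝ) → EuclideanSpace ℝ (Fin 3) → EuclideanSpace ℝ (Fin 3)) (P0 : (Fin N → ℝ) → EuclideanSpace ℝ (Fin 3) → ℝ) (b0 : (Fin N → ℝ) → Fin N → ℝ), BaseSpec N Γ ρ η Rw k Cs Cr α X u D U0 P0 b0 →
      ∃ (𝓚 : (Fin N → ℝ) → (EuclideanSpace ℝ (Fin 3) → EuclideanSpace ℝ (Fin 3)) → EuclideanSpace ℝ (Fin 3) → EuclideanSpace ℝ (Fin 3)) (𝓠 : (Fin N → ℝ) → (EuclideanSpace ℝ (Fin 3) → EuclideanSpace ℝ (Fin 3)) → EuclideanSpace ℝ (Fin 3) → ℝ) (𝓑 : (Fin N → ℝ) → (EuclideanSpace ℝ (Fin 3) → EuclideanSpace ℝ (Fin 3)) → Fin N → ℝ), GateSpec N Γ κ C₂ α D U0 𝓚 𝓠 𝓑 := by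
  rw [polynomialKelvinGate_iff_pos]
  constructor
  · intro h N δ ρ K Λ a b cnd η Rw Rb cg θ₀ hN hδ hρ ha hη hRw hRb hcg hθ₀ _ _ _ _ _ _ _
    exact h N δ ρ K Λ a b cnd η Rw Rb cg θ₀ hN hδ hρ ha hη hRw hRb hcg hθ₀
  · intro h N δ ρ K Λ a b cnd η Rw Rb cg θ₀ hN hδ hρ ha hη hRw hRb hcg hθ₀ Cs hCs
    by_cases hnd : cg ≤ 1 ∧ θ₀ ≤ 1 ∧ 0 ≤ K ∧ 3/2 + δ ≤ Λ ∧ 0 ≤ cnd ∧ (2 ≤ N → ρ ≤ 2 * Rw) ∧ (N = 1 → 0 < K)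
    · obtain ⟨h1, h2, h3, h4, h5, h6, h7⟩ := hnd
      exact h N δ ρ K Λ a b cnd η Rw Rb cg θ₀ hN hδ hρ ha hη hRw hRb hcg hθ₀ h1 h2 h3 h4 h5 h6 h7 Cs hCs
    · -- degenerate parameters: no box datum exists at `Γ ≥ 1`
      refine ⟨0, 0, fun k _ Cr _ => ⟨1, le_rfl, fun Γ hΓ γ α X w c m n u v A T D hu hv _ _ _ hbox => ?_⟩⟩
      exact absurd (BoxClausesJ.nondegenerate hN hδ hρ hθ₀ (by linarith) hu hv hbox) hnd

end Summit.NavierStokesRegularity.NavierStokesRegularity.Theorems.KelvinGate
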